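import Summits.QuantumFields.YangMills.Theorems.UnitScaleTiltHalvingP1FlatCorePreGauge
import Literature.MathematicalPhysics.QuantumFieldTheory.Balaban1983to89.B8Thm4AtLandau138
import Literature.MathematicalPhysics.QuantumFieldTheory.Balaban1983to89.B8Prop6OfThm4
import Literature.MathematicalPhysics.QuantumFieldTheory.Balaban1983to89.B8Ineq133CubeMemberGamma
import Literature.MathematicalPhysics.QuantumFieldTheory.Balaban1983to89.B8CubeMemberZd
import HarnessLib

/-!
# `hSupU` PROGRAMME (LEAD-H BOARD v2 (S3) ∕ RULING L-10; door author 2026-08-28T15:51Z «[R-i] — GO»), row [R-i] «J3 → THEOREM-4 JUNCTION CALL»: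
# node N05's Theorem-4 driver lit ✓`B8Thm4AtLandau138.thm4_exists_all_levels_landau138` CALLED AT THE FLAT BACKGROUND for the pre-gauged field of
# ✓`P1FlatCorePreGauge.exists_preGauge_flat` (J3), its hypotheses (1.33)∕(1.34)∕(1.66)₀ DISCHARGED from J3's letters, N05's sockets DISPLAYED —
# OUTPUT = Theorem 4's inductive datum `(u₁, W, A)` at every level `m ≤ k`, i.e. the datum block of ✓`HalvingP1FlatCoreSupplierTopCall.topRows_of_datum`
# (STAGE 3b FILE B) and of ✓`HalvingP1FlatCoreSupplierGaugeDescent` ([R-j]) LETTER FOR LETTER; plus FILE B's three other pre-gauged-field rows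
# (`h34`, `hAx`, `h135`) in J3's letters

Route `UnitScaleTilt`, crux K1 child «MinimiserStabilityRegPr» (stmt-QuantumFields-19200), registered stub `stub_halvingStep` (`BirthV10`), H = `hSupU`.
Cell `ym3-torus`, width seat `ym-ust-19200-w3` (gen 7).  `--supports stmt-QuantumFields-19200 --as helper`; THEOREMS ONLY (0 `def`, 0 `sorry`); count-neutral.

WHY.  The top step (✓`P1FlatCoreTopStepTorus.hFP_kLevel_top_RD`, called by FILE B) reads print's INDUCTIVE HYPOTHESIS (1.68)–(1.69) p. 88: the datum
`(u₁, U₁ = U′^{u₁⁻¹} = e^{iηA})` of Theorem 4 at `k − 1` levels for the pre-gauged field `U′`.  The junction J3 (✓`exists_preGauge_flat`) delivers exactly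
Theorem 4's HYPOTHESES at `U₀ = 1` — (1.33) trivially, (1.34)-𝔄 as `U′ ∈ 𝔄_k(ℤᵈ, ε₀)`, (1.66) as the fine near-`1` on the tower below its top box — and N05's
driver turns hypotheses into the datum, modulo its sockets.  This file is that call, so the final per-site assembly reads the datum BY NAME from
{J3, N05's sockets} instead of displaying it.

WHAT IS PROVED (sorry-free, no definition; generic `d`, `L`, C⋆-algebra `𝔸`):
* §1 `mulCfg_one_right` (`U′·1 = U′`), `h34_of_inAk_univ` ((1.34)-𝔄 on a member from J3 (a)), `hAx_of_inAx_one` (FILE B's `hAx` from J3 (b′)),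
  `h135_of_tower` (FILE B's `h135` from J3 (d) at every depth, through the displayed box inclusion `hΩtower`), `h66_of_fine` ((1.66)₀ on the sides of `Ω₀`
  from J3 (d) at depth `k`, through `hΩbox`).
* §2 ★★★ `datum_of_preGauge` — the driver at `U₀ := 1` with (1.33)∕(1.34)∕(1.66)₀ discharged; sockets `hP5base hP5 H42 H59` and windows VERBATIM.

HONEST SCOPE: by-name bookkeeping; [Balaban1985RegularSpaces] Theorem 4 ∕ Proposition 5 and [Balaban1985BackgroundPropagators] Thm 3.3 are NOT proved here
(node N05's theorem — not closed in the tree; its sockets are this file's displayed hypotheses).  Rung R3 (YM₃ on T³), NOT the Clay problem; YM gap NOT proved.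

References: T. Bałaban, CMP **99** (1985) 75–102 [Balaban1985RegularSpaces] (Thm 4 p.88, (1.33)–(1.35) p.82, (1.65)–(1.66) p.87, (1.68)–(1.69) p.88,
Prop. 5 p.94); CMP **98** (1985) 17–51 [Balaban1985Averaging] ((8) p.18, Prop. 2 p.26); T. Bałaban, CMP **96** (1984) 223–250 [Balaban1985BackgroundPropagators]
(Thm 3.3 p.398).
-/

set_option autoImplicit false

noncomputable section

namespace Summit.QuantumFields.YangMills.Theorems.HalvingP1FlatCoreSupplierInduction

open Literature.MathematicalPhysics.QuantumFieldTheory.Balaban1983to89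
open MatrixLog B7Prop1Explicit B7Prop2Explicit B7Prop1Local B7Eq92Concrete
open B8Lemma1NonAbelian (mulCfg)
open B8Ineq132 (covDerivFwd InAk BondTouches)
open B8Eq140Level (SideTouches sideTouches_of_bondTouches)
open B8Eq184Proof (gaugeExp cfgExp)
open B8Eq146AExpansion (iEta)
open B7Prop4GeneralLevels (logCovIter linCovIter)
open B8Eq155JBound (Jcur wsup)
open B8ScaledSupNorm (bondNorm msup)
open B7Prop3Flat (c3)
open B8Eq138LandauZd (IsLandau138W logCfg)
open B8Ineq130 (tlo thi)
open B8Eq119TwistedAxial (Restr129 InAx)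
open B8Thm4AtLandau138 (thm4_exists_all_levels_landau138)
open B8Prop6OfThm4 (one_inAk)
open B8Eq131Cubes (tLo tHi collar_cube)
open B8Eq131CubesAdmissible (cubeFam cubeFam_false_of_le)
open B8CubeMemberZd (hΩ_cubeFam)
open B8Ineq133CubeMemberGamma (ends_inBox_tilde_of_bondBox_subset_tcube bondBox_subset_tcube_of_subset_cubeFam)
open Summit.QuantumFields.YangMills.Theorems.P1FlatCorePreGauge (inAk_of_univ)

-- `Site` alone could resolve to the torus sites of `Setup.lean`; use the `ℤ^d` sites of `B7Prop1Explicit`.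
open B7Prop1Explicit (Site)

variable {d : ℕ}

section Main

variable {𝔸 : Type*} [CStarAlgebra 𝔸] [Nontrivial 𝔸]

/-! ## §1 The pre-gauged field's rows in FILE B's letters, from J3's letters -/

omit [Nontrivial 𝔸] in
/-- `U′·1 = U′` for the driver's product configuration `B8Lemma1NonAbelian.mulCfg`. [folklore] -/
theorem mulCfg_one_right (W : Site d → Fin d → 𝔸ˣ) : mulCfg W (1 : Site d → Fin d → 𝔸ˣ) = W := by
  funext x μ; simp [mulCfg]

omit [Nontrivial 𝔸] in
/-- **(1.34)-𝔄 ON A MEMBER FROM J3 (a)**: `U′ ∈ 𝔄_k(ℤᵈ, α₀)` gives `U′·1 ∈ 𝔄_k({Ω_j}, α₀)` for every region sequence — FILE B's `h34` ∕ the driver's `h34`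
at `U₀ = 1`. [cite: Balaban1985RegularSpaces, (1.7)-(1.9) p.77, (1.34) p.82] -/
theorem h34_of_inAk_univ {L k : ℕ} {η α₀ : ℝ} {U' : Site d → Fin d → 𝔸ˣ}
    (hInAk : InAk L k η α₀ (fun _ => (Set.univ : Set (Site d))) U') (Ω : ℕ → Set (Site d)) :
    InAk L k η α₀ Ω (mulCfg U' (1 : Site d → Fin d → 𝔸ˣ)) := by
  rw [mulCfg_one_right]; exact inAk_of_univ hInAk Ω

omit [Nontrivial 𝔸] in
/-- **FILE B's `hAx` FROM J3 (b′)**: `U′ ∈ Ax_m(Λ, 1)` for every `m ≤ k` and every family `Λ` gives `U′·1 ∈ Ax_{m′}(Λs m′, 1)` for every `m′ ≤ k`.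
[cite: Balaban1985RegularSpaces, (1.34) p.82, (1.19) p.79] -/
theorem hAx_of_inAx_one {L k : ℕ} {U' : Site d → Fin d → 𝔸ˣ}
    (hAx : ∀ m, m ≤ k → ∀ Λ : ℕ → Set (Site d), InAx L m Λ (1 : Site d → Fin d → 𝔸ˣ) U') (Λs : ℕ → ℕ → Set (Site d)) :
    ∀ m', m' ≤ k → InAx L m' (Λs m') (1 : Site d → Fin d → 𝔸ˣ) (mulCfg U' (1 : Site d → Fin d → 𝔸ˣ)) := by
  intro m' hm'
  rw [mulCfg_one_right]; exact hAx m' hm' (Λs m')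

omit [Nontrivial 𝔸] in
/-- **FILE B's `h135` FROM J3 (d) AT EVERY DEPTH**: if the pre-gauged field's `(k − m)`-fold averages are `α₁`-close to `1` on the depth-`m` blow-up of the top
box (`m ≤ k`), and every level-`j` bond whose fine box lies in `Ω_j` has its ends in the depth-`(k − j)` box (the displayed member inclusion `hΩtower`), then
`‖(U′·1)‾ʲ(z, μ) − 1̄ʲ(z, μ)‖ ≤ α₁` for all such bonds, `j ≤ k` (`1̄ʲ = 1`). [cite: Balaban1985RegularSpaces, (1.35) p.82, (1.65)-(1.66) p.87, (1.20) p.79] -/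
theorem h135_of_tower {L k : ℕ} {α₁ : ℝ} {U' : Site d → Fin d → 𝔸ˣ} {lo hi : Site d} {Ω : ℕ → Set (Site d)}
    (htw : ∀ m, m ≤ k → ∀ (x : Site d) (ν : Fin d), tlo L lo m ≤ x → x + e ν ≤ thi L hi m →
      ‖((avgIter L U' (k - m) x ν : 𝔸ˣ) : 𝔸) - 1‖ < α₁)
    (hΩtower : ∀ j, j ≤ k → ∀ (z : Site d) (μ : Fin d), (∀ x, InBox (loK L j z) (bondHiK L j z μ) x → x ∈ Ω j) →
      tlo L lo (k - j) ≤ z ∧ z + e μ ≤ thi L hi (k - j)) :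
    ∀ j, j ≤ k → ∀ (z : Site d) (μ : Fin d), (∀ x, InBox (loK L j z) (bondHiK L j z μ) x → x ∈ Ω j) →
      ‖(avgIter L (mulCfg U' (1 : Site d → Fin d → 𝔸ˣ)) j z μ : 𝔸) - (avgIter L (1 : Site d → Fin d → 𝔸ˣ) j z μ : 𝔸)‖ ≤ α₁ := by
  intro j hj z μ hbox
  obtain ⟨h1, h2⟩ := hΩtower j hj z μ hbox
  rw [mulCfg_one_right, B8Ineq132.avgIter_one, Pi.one_apply, Pi.one_apply, Units.val_one]
  have h := htw (k - j) (Nat.sub_le _ _) z μ h1 h2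
  rw [Nat.sub_sub_self hj] at h
  exact h.le

omit [Nontrivial 𝔸] in
/-- **THE DRIVER's (1.66)₀ FROM J3 (d) AT DEPTH `k`**: the fine near-`1` on `[tlo lo k, thi hi k]` gives `‖U′_b − 1‖ ≤ a` on every side touching `Ω₀` under the
displayed inclusion `hΩbox`. [cite: Balaban1985RegularSpaces, (1.66) p.87, p.77 (convention before (1.5))] -/
theorem h66_of_fine {L k : ℕ} {a : ℝ} {U' : Site d → Fin d → 𝔸ˣ} {lo hi : Site d} {Ω₀ : Set (Site d)}
    (hΩbox : ∀ (y : Site d) (τ : Fin d), SideTouches Ω₀ y τ → tlo L lo k ≤ y ∧ y + e τ ≤ thi L hi k)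
    (hfine : ∀ (x : Site d) (ν : Fin d), tlo L lo k ≤ x → x + e ν ≤ thi L hi k → ‖((U' x ν : 𝔸ˣ) : 𝔸) - 1‖ < a) :
    ∀ b ∈ {b : Site d × Fin d | SideTouches Ω₀ b.1 b.2}, ‖((U' b.1 b.2 : 𝔸ˣ) : 𝔸) - 1‖ ≤ a := by
  rintro ⟨y, τ⟩ hb
  obtain ⟨h1, h2⟩ := hΩbox y τ hb
  exact (hfine y τ h1 h2).le

/-! ## §2 The junction call -/

/-- ★★★ **THE J3 → THEOREM-4 JUNCTION CALL: THEOREM 4's INDUCTIVE DATUM AT EVERY LEVEL `m ≤ k` FOR THE FLAT PRE-GAUGED FIELD.**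
lit ✓`B8Thm4AtLandau138.thm4_exists_all_levels_landau138` at the flat background `U₀ := 1` with its three standing hypotheses DISCHARGED:
(1.33) `𝔄_k(Ω, α₀) ∋ 1` (lit ✓`B8Prop6OfThm4.one_inAk`), (1.34) from the pre-gauge's `𝔄_k(ℤᵈ, α₀) ∋ U′` (J3 (a), ✓`P1FlatCorePreGauge.inAk_of_univ`),
(1.66)₀ `‖U′_b − 1‖ ≤ a` on the sides touching `Ω₀` from the pre-gauge's fine near-`1` on the blow-up `[tlo lo k, thi hi k]` of its top box (J3 (d)
at depth `k`) through the displayed inclusion `hΩbox` (the member's `□₀ ± e ⊂ □̃`).  Everything else VERBATIM at `U₀ = 1`: the member geometry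
`(Ω, Λs, Λb, hbox)`, the constants∕windows, and node N05's four sockets `hP5base` (Prop. 5 at level 1), `hP5` (Prop. 5's step `m → m+1`),
`H42` ((1.42) per gauge-fixed field), `H59` ([4] Thm 3.3 in-edge b9).  CONCLUSION (= ✓`HalvingP1FlatCoreSupplierTopCall.topRows_of_datum`'s datum
block `hu₁ h129 hW hLan hdat` at `cs := cstar`, read at `m := k − 1`): for every `m ≤ k`, a unitary `u₁` with (1.29) at `m` levels, `W` with
`mgauge 1 u₁ W = U′`, (1.38) `IsLandau138W` at `m ≥ 1` levels, and `A` self-adjoint with `W_b = e^{iηA_b}`, `‖A_b‖ ≤ c⋆(Lʲη)⁻¹` on the sides of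
`Ω_j`, `j ≤ m`.  HONEST: a by-name call; Theorem 4 ∕ Proposition 5 ∕ [4] are NOT proved here (sockets displayed; node N05's theorem).
[cite: Balaban1985RegularSpaces, Thm 4 p.88, (1.33)-(1.35) p.82, (1.66) p.87, (1.68)-(1.69) p.88, Prop. 5 (1.107)-(1.108) p.94; Balaban1985BackgroundPropagators, Thm 3.3 p.398] -/
theorem datum_of_preGauge (hd2 : 2 ≤ d) {η : ℝ} (hη : 0 < η) {L : ℕ} (hL : 2 ≤ L) (k : ℕ)
    {U' : Site d → Fin d → 𝔸ˣ} (hU' : ∀ x κ, U' x κ ∈ unitaryUnits 𝔸)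
    {α₀ α₁ α₄ B₀ cstar a : ℝ} (hα₀ : 0 < α₀) (hα₁ : 0 ≤ α₁) (hα₄ : 0 ≤ α₄) (hB₀ : 0 ≤ B₀)
    (hc : cstar = 5 * d * L * B₀ * (α₀ + α₁))
    (hs₁ : α₄ ≤ 1 / 84) (hs₂ : L * cstar ≤ 1 / 12) (ha : a ≤ 1 / 4) (ha2 : 2 * a ≤ cstar)
    (hα3 : C0 d * α₀ ≤ 1 / 3) (hα4 : 4 * α₀ ≤ c2' d L)
    (h16 : 16 * (2 * (L * cstar) + 8 * α₄) ≤ 1) (hd5 : 5 * (2 * (L * cstar) + 8 * α₄) * ((d : ℝ) - 1) ≤ 4)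
    (hsmall : Real.exp (4 * (800 * ((d : ℝ) + 1) ^ 2 * ((d : ℝ) + 4)) * α₀)
      * (1 + 8 * (131072 * ((d : ℝ) + 1) ^ 2) * (2 * (L * cstar) + 8 * α₄)) ≤ 2)
    (hc₃ : 2 * (2 * (L * cstar) + 8 * α₄) ≤ c3 d L) (hside : 36 * d * B₀ * (2 * (L * cstar) + 8 * α₄) ≤ 1 / 2)
    (h50 : 50 * d * (2 * (L * cstar) + 8 * α₄) ≤ 1)
    {C₂ : ℝ} (hC₂ : 8 * (131072 * ((d : ℝ) + 1) ^ 2) * Real.exp (4 * (800 * ((d : ℝ) + 1) ^ 2 * ((d : ℝ) + 4)) * α₀) ≤ C₂)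
    (h61 : 2 * (2 * (L * cstar) + 8 * α₄) ^ 2 + 20 * d * α₀ * (2 * (L * cstar) + 8 * α₄)
      + 2 * C₂ * (2 * (L * cstar) + 8 * α₄) ^ 2 ≤ α₀ + α₁)
    (Ω : ℕ → Set (Site d)) (hΩ : ∀ j, Ω (j + 1) ⊆ Ω j) (Λs : ℕ → ℕ → Set (Site d)) (Λb : ℕ → ℕ → Set (Site d × Fin d))
    (hbox : ∀ m, m ≤ k → ∀ j, j ≤ m → ∀ c ∈ Λb m j, ∀ x, InBox (loK L j c.1) (bondHiK L j c.1 c.2) x → x ∈ Ω j)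
    -- THE PRE-GAUGED FIELD's ROWS IN J3's LETTERS: (1.34)-𝔄 on all of `ℤᵈ` (✓`exists_preGauge_flat` (a)) and the fine near-`1` on the blow-up of the top box (its (d) at depth `k`)
    (hInAk : InAk L k η α₀ (fun _ => (Set.univ : Set (Site d))) U')
    {lo hi : Site d} (hΩbox : ∀ (y : Site d) (τ : Fin d), SideTouches (Ω 0) y τ → tlo L lo k ≤ y ∧ y + e τ ≤ thi L hi k)
    (hfine : ∀ (x : Site d) (ν : Fin d), tlo L lo k ≤ x → x + e ν ≤ thi L hi k → ‖((U' x ν : 𝔸ˣ) : 𝔸) - 1‖ < a)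
    (hP5base : ∃ (v : Site d → 𝔸ˣ) (lam : Site d → 𝔸), (∀ x, v x ∈ unitaryUnits 𝔸) ∧
        (∀ j, j ≤ 1 → ∀ b ∈ {b : Site d × Fin d | SideTouches (Ω j) b.1 b.2}, (v b.1 : 𝔸) = ((gaugeExp lam b.1 : 𝔸ˣ) : 𝔸) ∧
          (v (b.1 + e b.2) : 𝔸) = ((gaugeExp lam (b.1 + e b.2) : 𝔸ˣ) : 𝔸)) ∧
        (∀ j, j ≤ 1 → ∀ b ∈ {b : Site d × Fin d | SideTouches (Ω j) b.1 b.2},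
          ‖lam b.1‖ ≤ α₄ ∧ ((L : ℝ) ^ j * η) * ‖covDerivFwd η (1 : Site d → Fin d → 𝔸ˣ) b.2 lam b.1‖ ≤ α₄) ∧
        IsLandau138W L 1 η (Ω 0) (Λs 1) (1 : Site d → Fin d → 𝔸ˣ) (mgauge (1 : Site d → Fin d → 𝔸ˣ) v⁻¹ U') ∧ Restr129 L 1 (Λs 1) (1 : Site d → Fin d → 𝔸ˣ) ((1 : Site d → 𝔸ˣ) * v))
    (hP5 : ∀ m, 1 ≤ m → m < k → ∀ (u₁ : Site d → 𝔸ˣ) (U₁ : Site d → Fin d → 𝔸ˣ) (A : Site d → Fin d → 𝔸),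
      (∀ x, u₁ x ∈ unitaryUnits 𝔸) → mgauge (1 : Site d → Fin d → 𝔸ˣ) u₁ U₁ = U' → Restr129 L m (Λs m) (1 : Site d → Fin d → 𝔸ˣ) u₁ → IsLandau138W L m η (Ω 0) (Λs m) (1 : Site d → Fin d → 𝔸ˣ) U₁ →
      (∀ j, j ≤ m → ∀ b ∈ {b : Site d × Fin d | SideTouches (Ω j) b.1 b.2},
        U₁ b.1 b.2 = cfgExp η A b.1 b.2 ∧ IsSelfAdjoint (A b.1 b.2) ∧ ‖A b.1 b.2‖ ≤ cstar * ((L : ℝ) ^ j * η)⁻¹) →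
      ∃ (v : Site d → 𝔸ˣ) (lam : Site d → 𝔸), (∀ x, v x ∈ unitaryUnits 𝔸) ∧
        (∀ j, j ≤ m + 1 → ∀ b ∈ {b : Site d × Fin d | SideTouches (Ω j) b.1 b.2}, (v b.1 : 𝔸) = ((gaugeExp lam b.1 : 𝔸ˣ) : 𝔸) ∧
          (v (b.1 + e b.2) : 𝔸) = ((gaugeExp lam (b.1 + e b.2) : 𝔸ˣ) : 𝔸)) ∧
        (∀ j, j ≤ m + 1 → ∀ b ∈ {b : Site d × Fin d | SideTouches (Ω j) b.1 b.2},
          ‖lam b.1‖ ≤ α₄ ∧ ((L : ℝ) ^ j * η) * ‖covDerivFwd η (1 : Site d → Fin d → 𝔸ˣ) b.2 lam b.1‖ ≤ α₄) ∧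
        IsLandau138W L (m + 1) η (Ω 0) (Λs (m + 1)) (1 : Site d → Fin d → 𝔸ˣ) (mgauge (1 : Site d → Fin d → 𝔸ˣ) v⁻¹ U₁) ∧ Restr129 L (m + 1) (Λs (m + 1)) (1 : Site d → Fin d → 𝔸ˣ) (u₁ * v))
    (H42 : ∀ m, 1 ≤ m → m ≤ k → ∀ (u : Site d → 𝔸ˣ) (W : Site d → Fin d → 𝔸ˣ) (A' : Site d → Fin d → 𝔸),
      (∀ x, u x ∈ unitaryUnits 𝔸) → mgauge (1 : Site d → Fin d → 𝔸ˣ) u W = U' → Restr129 L m (Λs m) (1 : Site d → Fin d → 𝔸ˣ) u → IsLandau138W L m η (Ω 0) (Λs m) (1 : Site d → Fin d → 𝔸ˣ) W →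
      (∀ y τ, IsSelfAdjoint (A' y τ)) →
      (∀ j, j ≤ m → ∀ y τ, SideTouches (Ω j) y τ →
        W y τ = cfgExp η A' y τ ∧ ‖A' y τ‖ ≤ (2 * (L * cstar) + 8 * α₄) * ((L : ℝ) ^ j * η)⁻¹) →
      (∀ y τ, (∀ j, j ≤ m → ¬ SideTouches (Ω j) y τ) → A' y τ = 0) →
      ∀ j, j ≤ m → ∀ c ∈ Λb m j, ‖logCovIter L (1 : Site d → Fin d → 𝔸ˣ) (iEta η A') j c.1 c.2‖ < 2 * d * L * α₁)
    (H59 : ∀ m, 1 ≤ m → m ≤ k → ∀ (u : Site d → 𝔸ˣ) (W : Site d → Fin d → 𝔸ˣ) (A' : Site d → Fin d → 𝔸),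
      (∀ x, u x ∈ unitaryUnits 𝔸) → mgauge (1 : Site d → Fin d → 𝔸ˣ) u W = U' → Restr129 L m (Λs m) (1 : Site d → Fin d → 𝔸ˣ) u → IsLandau138W L m η (Ω 0) (Λs m) (1 : Site d → Fin d → 𝔸ˣ) W →
      (∀ y τ, IsSelfAdjoint (A' y τ)) →
      (∀ j, j ≤ m → ∀ y τ, SideTouches (Ω j) y τ →
        W y τ = cfgExp η A' y τ ∧ ‖A' y τ‖ ≤ (2 * (L * cstar) + 8 * α₄) * ((L : ℝ) ^ j * η)⁻¹) →
      (∀ y τ, (∀ j, j ≤ m → ¬ SideTouches (Ω j) y τ) → A' y τ = 0) →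
      msup L m η (-(1 : ℝ)) (fun j (b : Site d × Fin d) => SideTouches (Ω j) b.1 b.2) (fun b => A' b.1 b.2)
          ≤ B₀ * (bondNorm L m η (-(3 : ℝ)) Ω (fun x μ => Jcur η (1 : Site d → Fin d → 𝔸ˣ) A' μ x)
            + wsup 1 (fun p : {p : ℕ × (Site d × Fin d) // p.1 ≤ m ∧ p.2 ∈ Λb m p.1} =>
                linCovIter L (1 : Site d → Fin d → 𝔸ˣ) (iEta η A') p.1.1 p.1.2.1 p.1.2.2)) ∧
        msup L m η (-(2 : ℝ)) (fun j (t : Fin d × Fin d × Site d) => SideTouches (Ω j) t.2.2 t.2.1)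
            (fun t => covDerivFwd η (1 : Site d → Fin d → 𝔸ˣ) t.1 (fun z => A' z t.2.1) t.2.2)
          ≤ B₀ * (bondNorm L m η (-(3 : ℝ)) Ω (fun x μ => Jcur η (1 : Site d → Fin d → 𝔸ˣ) A' μ x)
            + wsup 1 (fun p : {p : ℕ × (Site d × Fin d) // p.1 ≤ m ∧ p.2 ∈ Λb m p.1} =>
                linCovIter L (1 : Site d → Fin d → 𝔸ˣ) (iEta η A') p.1.1 p.1.2.1 p.1.2.2))) :
    ∀ m, m ≤ k → ∃ u : Site d → 𝔸ˣ, (∀ x, u x ∈ unitaryUnits 𝔸) ∧ Restr129 L m (Λs m) (1 : Site d → Fin d → 𝔸ˣ) u ∧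
      ∃ W : Site d → Fin d → 𝔸ˣ, mgauge (1 : Site d → Fin d → 𝔸ˣ) u W = U' ∧ (1 ≤ m → IsLandau138W L m η (Ω 0) (Λs m) (1 : Site d → Fin d → 𝔸ˣ) W) ∧
        ∃ A : Site d → Fin d → 𝔸, ∀ j, j ≤ m → ∀ b ∈ {b : Site d × Fin d | SideTouches (Ω j) b.1 b.2},
          W b.1 b.2 = cfgExp η A b.1 b.2 ∧ IsSelfAdjoint (A b.1 b.2) ∧ ‖A b.1 b.2‖ ≤ cstar * ((L : ℝ) ^ j * η)⁻¹ := by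
  have hL1 : 1 ≤ L := le_trans (by norm_num) hL
  have hU₀ : ∀ (x : Site d) (κ : Fin d), (1 : Site d → Fin d → 𝔸ˣ) x κ ∈ unitaryUnits 𝔸 := fun _ _ => one_mem _
  have h33 : InAk L k η α₀ Ω (1 : Site d → Fin d → 𝔸ˣ) := one_inAk hL1 k hη hα₀ Ω
  have h34 : InAk L k η α₀ Ω (mulCfg U' (1 : Site d → Fin d → 𝔸ˣ)) := by
    rw [mulCfg_one_right]; exact inAk_of_univ hInAk Ω
  have h66 : ∀ b ∈ {b : Site d × Fin d | SideTouches (Ω 0) b.1 b.2}, ‖((U' b.1 b.2 : 𝔸ˣ) : 𝔸) - 1‖ ≤ a := by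
    rintro ⟨y, τ⟩ hb
    obtain ⟨h1, h2⟩ := hΩbox y τ hb
    exact (hfine y τ h1 h2).le
  exact thm4_exists_all_levels_landau138 hd2 hη hL k hU₀ hU' hα₀ hα₁ hα₄ hB₀ hc hs₁ hs₂ ha ha2 hα3 hα4 h16 hd5 hsmall hc₃ hside h50
    hC₂ h61 Ω hΩ Λs Λb hbox h33 h34 h66 hP5base hP5 H42 H59

/-! ## §3 At N05's cube member: the displayed inclusions discharged -/

omit [Nontrivial 𝔸] in
/-- **SIDES OF A COLLARED SET LIE IN THE BOX**: if every unit neighbour of `S` lies in `[lo, hi]` (`B8Ineq132.Collar`) then every bond `⟨y, y + e_τ⟩` that is a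
side of a plaquette touching `S` has `lo ≤ y` and `y + e_τ ≤ hi` (both far corners of the plaquette are in the box, lit ✓`B8Ineq132.plaq_inBox`).
[cite: Balaban1985RegularSpaces, p.77 (convention before (1.5)), p.98 (the collar of □₀ in □̃)] -/
theorem ends_of_sideTouches {S : Set (Site d)} {lo hi : Site d} (hS : B8Ineq132.Collar S lo hi) {y : Site d} {τ : Fin d}
    (h : SideTouches S y τ) : lo ≤ y ∧ y + e τ ≤ hi := by
  obtain ⟨z, κ, ν, hκν, hp, hs⟩ := h
  obtain ⟨h1, h2⟩ := B8Ineq132.plaq_inBox hS hκν hp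
  have hz : lo ≤ z := fun i => (h1 i).1
  have hzz : z + e κ + e ν ≤ hi := fun i => (h2 i).2
  have heκ : (0 : Site d) ≤ e κ := B8Lemma1NonAbelian.e_nonneg κ
  have heν : (0 : Site d) ≤ e ν := B8Lemma1NonAbelian.e_nonneg ν
  rcases hs with ⟨rfl, rfl⟩ | ⟨rfl, rfl⟩ | ⟨rfl, rfl⟩ | ⟨rfl, rfl⟩
  · exact ⟨hz, le_trans (le_add_of_nonneg_right heν) hzz⟩
  · exact ⟨le_trans hz (le_add_of_nonneg_right heκ), hzz⟩
  · exact ⟨le_trans hz (le_add_of_nonneg_right heν), by rw [add_right_comm]; exact hzz⟩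
  · refine ⟨hz, le_trans ?_ hzz⟩
    rw [add_right_comm]; exact le_add_of_nonneg_right heκ

omit [Nontrivial 𝔸] in
/-- **THE BOX LAW AT THE MEMBER** (FILE B's `h135` guard ⇒ J3's tower box): a level-`j` bond whose fine box lies in `□_j` (`j ≤ k`) has both coarse ends in
`□̃^{(j)}` = the depth-`(k − j)` tower box of `[tLo a ρ, tHi a M ρ]` (lit ✓`bondBox_subset_tcube_of_subset_cubeFam` ∘ ✓`ends_inBox_tilde_of_bondBox_subset_tcube`).
[cite: Balaban1985RegularSpaces, p.98, (1.133) p.99] -/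
theorem hΩtower_cubeMember {L : ℕ} (hL : 2 ≤ L) (aC : Site d) (M : ℕ) {ρ : ℕ} (hρ1 : 1 ≤ ρ) (k : ℕ) :
    ∀ j, j ≤ k → ∀ (z : Site d) (μ : Fin d), (∀ x, InBox (loK L j z) (bondHiK L j z μ) x → x ∈ cubeFam false L aC M ρ k j) →
      tlo L (tLo aC ρ) (k - j) ≤ z ∧ z + e μ ≤ thi L (tHi aC M ρ) (k - j) := by
  have hL1 : 1 ≤ L := le_trans (by norm_num) hL
  intro j hj z μ hbox
  exact ends_inBox_tilde_of_bondBox_subset_tcube hL1 aC M ρ hj (bondBox_subset_tcube_of_subset_cubeFam hL aC M hρ1 hj hbox)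

omit [Nontrivial 𝔸] in
/-- **FILE B's `h135` AT THE MEMBER FROM J3 (d)** at every depth on the tilde-cube's tower. [cite: Balaban1985RegularSpaces, (1.35) p.82, (1.65)-(1.66) p.87, (1.133) p.99] -/
theorem h135_cubeMember {L : ℕ} (hL : 2 ≤ L) (aC : Site d) (M : ℕ) {ρ : ℕ} (hρ1 : 1 ≤ ρ) {k : ℕ} {α₁ : ℝ} {U' : Site d → Fin d → 𝔸ˣ}
    (htw : ∀ m, m ≤ k → ∀ (x : Site d) (ν : Fin d), tlo L (tLo aC ρ) m ≤ x → x + e ν ≤ thi L (tHi aC M ρ) m →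
      ‖((avgIter L U' (k - m) x ν : 𝔸ˣ) : 𝔸) - 1‖ < α₁) :
    ∀ j, j ≤ k → ∀ (z : Site d) (μ : Fin d), (∀ x, InBox (loK L j z) (bondHiK L j z μ) x → x ∈ cubeFam false L aC M ρ k j) →
      ‖(avgIter L (mulCfg U' (1 : Site d → Fin d → 𝔸ˣ)) j z μ : 𝔸) - (avgIter L (1 : Site d → Fin d → 𝔸ˣ) j z μ : 𝔸)‖ ≤ α₁ :=
  h135_of_tower htw (hΩtower_cubeMember hL aC M hρ1 k)

/-- ★★★ **THE JUNCTION CALL AT N05's CUBE MEMBER OF RECORD** `Ω_j := □_j = cubeFam false L a M ρ k j` (lit `B8CubeMemberZd`: `hΩ_cubeFam`), with J3's top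
box THE TILDE-CUBE `□̃^{(k)} = [tLo a ρ, tHi a M ρ]` (= ✓`HalvingP1FlatCoreSupplierPreGauge` §2's box): `datum_of_preGauge` with the nesting `hΩ` and the side
inclusion `hΩbox` DISCHARGED (every side touching `□₀` lies in `□̃`: lit ✓`B8Eq131Cubes.collar_cube` + `ends_of_sideTouches`).  Remaining displayed: `Λs Λb hbox`
(FILE B's), the constants∕windows, J3's two rows `hInAk`∕`hfine`, and the four sockets. [cite: Balaban1985RegularSpaces, Thm 4 p.88, p.98 (the collar of □₀ in □̃), (1.66) p.87] -/
theorem datum_of_preGauge_cubeMember (hd2 : 2 ≤ d) {η : ℝ} (hη : 0 < η) {L : ℕ} (hL : 2 ≤ L) (k : ℕ)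
    {U' : Site d → Fin d → 𝔸ˣ} (hU' : ∀ x κ, U' x κ ∈ unitaryUnits 𝔸)
    {α₀ α₁ α₄ B₀ cstar a : ℝ} (hα₀ : 0 < α₀) (hα₁ : 0 ≤ α₁) (hα₄ : 0 ≤ α₄) (hB₀ : 0 ≤ B₀)
    (hc : cstar = 5 * d * L * B₀ * (α₀ + α₁))
    (hs₁ : α₄ ≤ 1 / 84) (hs₂ : L * cstar ≤ 1 / 12) (ha : a ≤ 1 / 4) (ha2 : 2 * a ≤ cstar)
    (hα3 : C0 d * α₀ ≤ 1 / 3) (hα4 : 4 * α₀ ≤ c2' d L)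
    (h16 : 16 * (2 * (L * cstar) + 8 * α₄) ≤ 1) (hd5 : 5 * (2 * (L * cstar) + 8 * α₄) * ((d : ℝ) - 1) ≤ 4)
    (hsmall : Real.exp (4 * (800 * ((d : ℝ) + 1) ^ 2 * ((d : ℝ) + 4)) * α₀)
      * (1 + 8 * (131072 * ((d : ℝ) + 1) ^ 2) * (2 * (L * cstar) + 8 * α₄)) ≤ 2)
    (hc₃ : 2 * (2 * (L * cstar) + 8 * α₄) ≤ c3 d L) (hside : 36 * d * B₀ * (2 * (L * cstar) + 8 * α₄) ≤ 1 / 2)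
    (h50 : 50 * d * (2 * (L * cstar) + 8 * α₄) ≤ 1)
    {C₂ : ℝ} (hC₂ : 8 * (131072 * ((d : ℝ) + 1) ^ 2) * Real.exp (4 * (800 * ((d : ℝ) + 1) ^ 2 * ((d : ℝ) + 4)) * α₀) ≤ C₂)
    (h61 : 2 * (2 * (L * cstar) + 8 * α₄) ^ 2 + 20 * d * α₀ * (2 * (L * cstar) + 8 * α₄)
      + 2 * C₂ * (2 * (L * cstar) + 8 * α₄) ^ 2 ≤ α₀ + α₁)
    (aC : Site d) (M : ℕ) {ρ : ℕ} (hρ : L ≤ ρ) (Λs : ℕ → ℕ → Set (Site d)) (Λb : ℕ → ℕ → Set (Site d × Fin d))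
    (hbox : ∀ m, m ≤ k → ∀ j, j ≤ m → ∀ c ∈ Λb m j, ∀ x, InBox (loK L j c.1) (bondHiK L j c.1 c.2) x → x ∈ (cubeFam false L aC M ρ k) j)
    -- THE PRE-GAUGED FIELD's ROWS IN J3's LETTERS: (1.34)-𝔄 on all of `ℤᵈ` (✓`exists_preGauge_flat` (a)) and the fine near-`1` on `□̃` = the blow-up of the top box `[tLo, tHi]` (its (d) at depth `k`)
    (hInAk : InAk L k η α₀ (fun _ => (Set.univ : Set (Site d))) U')
    (hfine : ∀ (x : Site d) (ν : Fin d), tlo L (tLo aC ρ) k ≤ x → x + e ν ≤ thi L (tHi aC M ρ) k → ‖((U' x ν : 𝔸ˣ) : 𝔸) - 1‖ < a)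
    (hP5base : ∃ (v : Site d → 𝔸ˣ) (lam : Site d → 𝔸), (∀ x, v x ∈ unitaryUnits 𝔸) ∧
        (∀ j, j ≤ 1 → ∀ b ∈ {b : Site d × Fin d | SideTouches ((cubeFam false L aC M ρ k) j) b.1 b.2}, (v b.1 : 𝔸) = ((gaugeExp lam b.1 : 𝔸ˣ) : 𝔸) ∧
          (v (b.1 + e b.2) : 𝔸) = ((gaugeExp lam (b.1 + e b.2) : 𝔸ˣ) : 𝔸)) ∧
        (∀ j, j ≤ 1 → ∀ b ∈ {b : Site d × Fin d | SideTouches ((cubeFam false L aC M ρ k) j) b.1 b.2},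
          ‖lam b.1‖ ≤ α₄ ∧ ((L : ℝ) ^ j * η) * ‖covDerivFwd η (1 : Site d → Fin d → 𝔸ˣ) b.2 lam b.1‖ ≤ α₄) ∧
        IsLandau138W L 1 η ((cubeFam false L aC M ρ k) 0) (Λs 1) (1 : Site d → Fin d → 𝔸ˣ) (mgauge (1 : Site d → Fin d → 𝔸ˣ) v⁻¹ U') ∧ Restr129 L 1 (Λs 1) (1 : Site d → Fin d → 𝔸ˣ) ((1 : Site d → 𝔸ˣ) * v))
    (hP5 : ∀ m, 1 ≤ m → m < k → ∀ (u₁ : Site d → 𝔸ˣ) (U₁ : Site d → Fin d → 𝔸ˣ) (A : Site d → Fin d → 𝔸),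
      (∀ x, u₁ x ∈ unitaryUnits 𝔸) → mgauge (1 : Site d → Fin d → 𝔸ˣ) u₁ U₁ = U' → Restr129 L m (Λs m) (1 : Site d → Fin d → 𝔸ˣ) u₁ → IsLandau138W L m η ((cubeFam false L aC M ρ k) 0) (Λs m) (1 : Site d → Fin d → 𝔸ˣ) U₁ →
      (∀ j, j ≤ m → ∀ b ∈ {b : Site d × Fin d | SideTouches ((cubeFam false L aC M ρ k) j) b.1 b.2},
        U₁ b.1 b.2 = cfgExp η A b.1 b.2 ∧ IsSelfAdjoint (A b.1 b.2) ∧ ‖A b.1 b.2‖ ≤ cstar * ((L : ℝ) ^ j * η)⁻¹) →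
      ∃ (v : Site d → 𝔸ˣ) (lam : Site d → 𝔸), (∀ x, v x ∈ unitaryUnits 𝔸) ∧
        (∀ j, j ≤ m + 1 → ∀ b ∈ {b : Site d × Fin d | SideTouches ((cubeFam false L aC M ρ k) j) b.1 b.2}, (v b.1 : 𝔸) = ((gaugeExp lam b.1 : 𝔸ˣ) : 𝔸) ∧
          (v (b.1 + e b.2) : 𝔸) = ((gaugeExp lam (b.1 + e b.2) : 𝔸ˣ) : 𝔸)) ∧
        (∀ j, j ≤ m + 1 → ∀ b ∈ {b : Site d × Fin d | SideTouches ((cubeFam false L aC M ρ k) j) b.1 b.2},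
          ‖lam b.1‖ ≤ α₄ ∧ ((L : ℝ) ^ j * η) * ‖covDerivFwd η (1 : Site d → Fin d → 𝔸ˣ) b.2 lam b.1‖ ≤ α₄) ∧
        IsLandau138W L (m + 1) η ((cubeFam false L aC M ρ k) 0) (Λs (m + 1)) (1 : Site d → Fin d → 𝔸ˣ) (mgauge (1 : Site d → Fin d → 𝔸ˣ) v⁻¹ U₁) ∧ Restr129 L (m + 1) (Λs (m + 1)) (1 : Site d → Fin d → 𝔸ˣ) (u₁ * v))
    (H42 : ∀ m, 1 ≤ m → m ≤ k → ∀ (u : Site d → 𝔸ˣ) (W : Site d → Fin d → 𝔸ˣ) (A' : Site d → Fin d → 𝔸),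
      (∀ x, u x ∈ unitaryUnits 𝔸) → mgauge (1 : Site d → Fin d → 𝔸ˣ) u W = U' → Restr129 L m (Λs m) (1 : Site d → Fin d → 𝔸ˣ) u → IsLandau138W L m η ((cubeFam false L aC M ρ k) 0) (Λs m) (1 : Site d → Fin d → 𝔸ˣ) W →
      (∀ y τ, IsSelfAdjoint (A' y τ)) →
      (∀ j, j ≤ m → ∀ y τ, SideTouches ((cubeFam false L aC M ρ k) j) y τ →
        W y τ = cfgExp η A' y τ ∧ ‖A' y τ‖ ≤ (2 * (L * cstar) + 8 * α₄) * ((L : ℝ) ^ j * η)⁻¹) →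
      (∀ y τ, (∀ j, j ≤ m → ¬ SideTouches ((cubeFam false L aC M ρ k) j) y τ) → A' y τ = 0) →
      ∀ j, j ≤ m → ∀ c ∈ Λb m j, ‖logCovIter L (1 : Site d → Fin d → 𝔸ˣ) (iEta η A') j c.1 c.2‖ < 2 * d * L * α₁)
    (H59 : ∀ m, 1 ≤ m → m ≤ k → ∀ (u : Site d → 𝔸ˣ) (W : Site d → Fin d → 𝔸ˣ) (A' : Site d → Fin d → 𝔸),
      (∀ x, u x ∈ unitaryUnits 𝔸) → mgauge (1 : Site d → Fin d → 𝔸ˣ) u W = U' → Restr129 L m (Λs m) (1 : Site d → Fin d → 𝔸ˣ) u → IsLandau138W L m η ((cubeFam false L aC M ρ k) 0) (Λs m) (1 : Site d → Fin d → 𝔸ˣ) W →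
      (∀ y τ, IsSelfAdjoint (A' y τ)) →
      (∀ j, j ≤ m → ∀ y τ, SideTouches ((cubeFam false L aC M ρ k) j) y τ →
        W y τ = cfgExp η A' y τ ∧ ‖A' y τ‖ ≤ (2 * (L * cstar) + 8 * α₄) * ((L : ℝ) ^ j * η)⁻¹) →
      (∀ y τ, (∀ j, j ≤ m → ¬ SideTouches ((cubeFam false L aC M ρ k) j) y τ) → A' y τ = 0) →
      msup L m η (-(1 : ℝ)) (fun j (b : Site d × Fin d) => SideTouches ((cubeFam false L aC M ρ k) j) b.1 b.2) (fun b => A' b.1 b.2)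
          ≤ B₀ * (bondNorm L m η (-(3 : ℝ)) (cubeFam false L aC M ρ k) (fun x μ => Jcur η (1 : Site d → Fin d → 𝔸ˣ) A' μ x)
            + wsup 1 (fun p : {p : ℕ × (Site d × Fin d) // p.1 ≤ m ∧ p.2 ∈ Λb m p.1} =>
                linCovIter L (1 : Site d → Fin d → 𝔸ˣ) (iEta η A') p.1.1 p.1.2.1 p.1.2.2)) ∧
        msup L m η (-(2 : ℝ)) (fun j (t : Fin d × Fin d × Site d) => SideTouches ((cubeFam false L aC M ρ k) j) t.2.2 t.2.1)
            (fun t => covDerivFwd η (1 : Site d → Fin d → 𝔸ˣ) t.1 (fun z => A' z t.2.1) t.2.2)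
          ≤ B₀ * (bondNorm L m η (-(3 : ℝ)) (cubeFam false L aC M ρ k) (fun x μ => Jcur η (1 : Site d → Fin d → 𝔸ˣ) A' μ x)
            + wsup 1 (fun p : {p : ℕ × (Site d × Fin d) // p.1 ≤ m ∧ p.2 ∈ Λb m p.1} =>
                linCovIter L (1 : Site d → Fin d → 𝔸ˣ) (iEta η A') p.1.1 p.1.2.1 p.1.2.2))) :
    ∀ m, m ≤ k → ∃ u : Site d → 𝔸ˣ, (∀ x, u x ∈ unitaryUnits 𝔸) ∧ Restr129 L m (Λs m) (1 : Site d → Fin d → 𝔸ˣ) u ∧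
      ∃ W : Site d → Fin d → 𝔸ˣ, mgauge (1 : Site d → Fin d → 𝔸ˣ) u W = U' ∧ (1 ≤ m → IsLandau138W L m η ((cubeFam false L aC M ρ k) 0) (Λs m) (1 : Site d → Fin d → 𝔸ˣ) W) ∧
        ∃ A : Site d → Fin d → 𝔸, ∀ j, j ≤ m → ∀ b ∈ {b : Site d × Fin d | SideTouches ((cubeFam false L aC M ρ k) j) b.1 b.2},
          W b.1 b.2 = cfgExp η A b.1 b.2 ∧ IsSelfAdjoint (A b.1 b.2) ∧ ‖A b.1 b.2‖ ≤ cstar * ((L : ℝ) ^ j * η)⁻¹ := by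
  have hL1 : 1 ≤ L := le_trans (by norm_num) hL
  have hρ1 : 1 ≤ ρ := le_trans hL1 hρ
  refine datum_of_preGauge hd2 hη hL k hU' hα₀ hα₁ hα₄ hB₀ hc hs₁ hs₂ ha ha2 hα3 hα4 h16 hd5 hsmall hc₃ hside h50 hC₂ h61
    (cubeFam false L aC M ρ k) (hΩ_cubeFam hL1 aC M hρ k) Λs Λb hbox hInAk (fun y τ hyτ => ?_) hfine hP5base hP5 H42 H59
  rw [cubeFam_false_of_le L aC M ρ (Nat.zero_le k)] at hyτ
  exact ends_of_sideTouches (collar_cube hL hρ1 (Nat.zero_le k)) hyτ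

end Main

end Summit.QuantumFields.YangMills.Theorems.HalvingP1FlatCoreSupplierInduction

end
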